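import Mathlib
import Summits.QuantumFields.BalabanUV.Beta.CovariantBoxPoincare
import Summits.QuantumFields.BalabanUV.Beta.CovariantPlateauBlocksPairCurl

/-!
# Beta / CovariantBoxPoincareBlocks — THE (P) → (B) DEFECT BRIDGE: d4-p2's covariant block Poincaré inequality
# (`CovariantBoxPoincare.covariant_box_poincare`, pv21 `covD` currency, tree-gauge defect `h` as DATA) INSTANTIATED on
# the fibred block carrier of `CovariantPlateauBlocks` (blocks `Y` × offsets `(Fin n)^ν`, ANY orthogonal bond
# transporters `W`, the B5 (1.7) tree transports `Rtr`), with the defect SUPPLIED by the lineage's `hdef` — hence by the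
# in-block plaquettes (`hdef_le_of_plaqW`: `h = ν(n−1)·α`) and by the (3.35) SHAPE as displayed (`hplaqW_of_gauge335`:
# `α = 2f + 2a²`) (unit `b2b-balaban-beta-d4-p3`, GEN 8, road P3 «reduction road»; item «(P)→(B) bridge» = C-d4p3-26
# INFO-2, GO by d4-p2-g7 journal l.17528)

HONEST FRAMING: discharging `BetaPertH` makes Bałaban's UV stability UNCONDITIONAL — NOT the continuum limit, NOT the
Clay problem.  HONEST DEPENDENCY (verbatim): «continuum YM on T⁴ ⇐ BetaPertH ∧ nine spine estimates (0/9 proved);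
BetaPertH ⇐ (D1) ∧ (D4) ∧ CAP+tail; G-an2-4 gates asym, D1 and NE2/3/4.»  THIS MODULE DISCHARGES NOTHING of `BetaPertH`,
asserts NOTHING printed and cites nothing as a fact (ABSOLUTE RULE): [folklore] linear algebra about the MODEL (cubic
blocks, tree transports, orthogonal fibre transporters as DATA): the real quadratic-form defect of d4-p2's box holonomy
`Hol = T(x)·Rm(b)·T(x⁺)ᵀ` with `T := Rtr`, `Rm := W` IS the lineage's `hdef = ‖cpx(W_b·R(tgt b)ᵀ·R(src b)) − 1‖`
(an orthogonal conjugate; real vectors inside the complex `ℓ²`-operator norm).  [B9] = `Balaban1985BackgroundPropagators`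
(3.19) p. 393, (3.24) p. 394, (3.35) p. 396 are LOCATORS of the shapes only; the plaquette ∕ (3.35)-shape bounds stay
HYPOTHESES.  No class change on row D4 or G-B9-15 (readiness width 0; D4 DISCHARGE NO DATE); NOT BetaPertH, NOT
continuum, NOT Clay, NOT summit progress.

CONTENT (kernel, 0 sorry).  §1 real quadratic forms under the complex operator norm: `sum_sq_mulVec_le`
(`Σ_a (Σ_j M_{aj}u_j)² ≤ ‖cpx M‖²·Σ_j u_j²`).  §2 the block chart of block `y` (`φ v = (y, v)`, bonds `((y,v), i)`,
`T := Rtr`, `Rm := W`; d4-p2's `succ` is this carrier's `succOff` by `rfl`): `htgt`∕`hT` discharged (`hsrc` is `rfl`); **`hol_blocks_eq`** (d4-p2's `hol` = `Rtr(x)·W_b·Rtr(x⁺)ᵀ`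
entrywise) and **`hol_blocks_sub_one_eq_conj`** (`= Rtr(x)·(hol_owner − 1)·Rtr(x)ᵀ`).  §3 **`hHol_of_hdef`**: the
hypothesis `hHol` of `covariant_box_poincare` holds with `h := hdef` bondwise, hence with any `h ≥ hdef` on the block's
in-box bonds.  §4 ENDs **`covariant_box_poincare_blocks`** (h as data, `hdef ≤ h` on the block),
**`covariant_box_poincare_blocks_of_plaqW`** (`h = ν(n−1)·α` from the in-block plaquettes) and
**`covariant_box_poincare_blocks_of_gauge335`** (`α = 2f + 2a²` from the (3.35) SHAPE, both halves, via
`CovariantPlateauBlocksPairCurl.hplaqW_of_gauge335`): `(1 − 4P·ν·h²)·Σ_v|f(y,v)|² ≤ (4P/c_min²)·Σ_{in-block bonds}|∇_W f|²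
+ (2/n^ν)·|Σ_v Rtr(y,v) f(y,v)|²`, `P = νn(n−1)` — j-uniform exactly when `n²α = O(Mα₀)` (loss `≍ 4ν⁴(n²α)²`).  §5 a flat
non-vacuity witness.  UNIVERSES: d4-p2's (B) is stated over `Type`; this file follows (`Y Cp : Type`).
-/

namespace Summit.QuantumFields.BalabanUV.Beta.CovariantBoxPoincareBlocks

open scoped BigOperators Matrix Matrix.Norms.L2Operator
open Finset Function
open Summit.QuantumFields.BalabanUV.Beta.BoxPoincare (Box)
open Summit.QuantumFields.BalabanUV.Beta.CovariantBoxPoincare (tf succ covariant_box_poincare)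
open Summit.QuantumFields.BalabanUV.Beta.CovariantPlateauBlocks
open Summit.QuantumFields.BalabanUV.Beta.ThinLoopHolonomy (cpxHom norm_cpxHom_le_one norm_toLp_mulVec_le)
open Literature.MathematicalPhysics.QuantumFieldTheory.Balaban1983to89.B9Thm37Glue (covD covD_apply)

noncomputable section

/-! ## §1 Real quadratic forms under the complex `ℓ²`-operator norm -/

section RealForm

variable {Cp : Type} [Fintype Cp] [DecidableEq Cp]

/-- For a real fibre matrix `M` and a REAL fibre vector `u`: `Σ_a (Σ_j M_{aj} u_j)² ≤ ‖cpx M‖²·Σ_j u_j²`, `‖·‖` the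
`ℓ²`-operator norm of the complexification (the real vector read as a complex one). [folklore] -/
theorem sum_sq_mulVec_le (M : Matrix Cp Cp ℝ) (u : Cp → ℝ) :
    ∑ a, (∑ j, M a j * u j) ^ 2 ≤ ‖cpxHom M‖ ^ 2 * ∑ j, u j ^ 2 := by
  set v : Cp → ℂ := fun j => ((u j : ℝ) : ℂ) with hv
  have h := norm_toLp_mulVec_le (cpxHom M) v
  have hv2 : ‖(WithLp.toLp 2 v : EuclideanSpace ℂ Cp)‖ ^ 2 = ∑ j, u j ^ 2 := by
    rw [EuclideanSpace.norm_sq_eq]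
    refine Finset.sum_congr rfl fun j _ => ?_
    simp [hv, Complex.norm_real, sq_abs]
  have hMv : ‖(WithLp.toLp 2 (cpxHom M *ᵥ v) : EuclideanSpace ℂ Cp)‖ ^ 2 = ∑ a, (∑ j, M a j * u j) ^ 2 := by
    rw [EuclideanSpace.norm_sq_eq]
    refine Finset.sum_congr rfl fun a _ => ?_
    have : (cpxHom M *ᵥ v) a = ((∑ j, M a j * u j : ℝ) : ℂ) := by
      simp only [Matrix.mulVec, dotProduct, hv, ThinLoopHolonomy.cpxHom_apply]
      push_cast
      rfl
    rw [PiLp.toLp_apply, this, Complex.norm_real, Real.norm_eq_abs, sq_abs]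
  have h0 : 0 ≤ ‖(WithLp.toLp 2 (cpxHom M *ᵥ v) : EuclideanSpace ℂ Cp)‖ := norm_nonneg _
  calc ∑ a, (∑ j, M a j * u j) ^ 2 = ‖(WithLp.toLp 2 (cpxHom M *ᵥ v) : EuclideanSpace ℂ Cp)‖ ^ 2 := hMv.symm
    _ ≤ (‖cpxHom M‖ * ‖(WithLp.toLp 2 v : EuclideanSpace ℂ Cp)‖) ^ 2 := pow_le_pow_left₀ h0 h 2
    _ = ‖cpxHom M‖ ^ 2 * ∑ j, u j ^ 2 := by rw [mul_pow, hv2]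

/-- The quadratic form of `M − 1` in d4-p2's spelling: `Σ_j (M_{aj} − δ_{aj}) u_j = ((M − 1)u)_a`. [folklore] -/
theorem sum_sub_delta_mul (M : Matrix Cp Cp ℝ) (u : Cp → ℝ) (a : Cp) :
    ∑ j, (M a j - if a = j then 1 else 0) * u j = ∑ j, (M - 1) a j * u j := by
  refine Finset.sum_congr rfl fun j _ => ?_
  rw [Matrix.sub_apply, Matrix.one_apply]

end RealForm

/-! ## §2 The block chart: d4-p2's box data on the fibred block carrier -/

section Chart

variable {Y : Type} {Cp : Type} [Fintype Cp] [DecidableEq Cp] {ν n : ℕ} [NeZero n]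
variable (W : Bond Y ν n → Matrix Cp Cp ℝ) (hW : ∀ b, (W b)ᵀ * W b = 1) (σ : Fin ν → Y → Y) (y : Y)

/-- `htgt`: an in-block bond `((y,v), i)` ends at the chart point `(y, v + e_i)`. [folklore] -/
theorem btgt_chart (v : Off ν n) (i : Fin ν) (hv : (v i : ℕ) + 1 < n) :
    btgt σ (((y, v), i) : Bond Y ν n) = (y, succ v i hv) := by
  rw [btgt_of_inBlk σ (b := (((y, v), i) : Bond Y ν n)) hv]
  rfl

/-- `hT`: the tree transports have orthonormal columns, `Σ_k R(x)_{ki} R(x)_{ki′} = δ_{ii′}`. [folklore] -/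
theorem Rtr_cols_orthonormal (x : BSite Y ν n) (i i' : Cp) :
    ∑ k, Rtr W hW x k i * Rtr W hW x k i' = if i = i' then (1 : ℝ) else 0 := by
  have h := congrFun (congrFun (transpose_mul_Rtr W hW x) i) i'
  rw [Matrix.mul_apply, Matrix.one_apply] at h
  simpa only [Matrix.transpose_apply] using h

/-- **d4-p2's box holonomy on this carrier is `Rtr(x)·W_b·Rtr(x⁺)ᵀ` entrywise** (`x = (y,v)`, `b = (x, i)`,
`x⁺ = (y, v + e_i)`). [cite: Balaban1985BackgroundPropagators, (3.19) p.393] -/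
theorem hol_blocks_eq (v : Off ν n) (i : Fin ν) (hv : (v i : ℕ) + 1 < n) (a j : Cp) :
    CovariantBoxPoincare.hol (fun b : Bond Y ν n => (W b : Cp → Cp → ℝ)) (fun v : Box ν n => (Rtr W hW (y, v) : Cp → Cp → ℝ))
        (fun (v : Box ν n) (i : Fin ν) (_ : (v i : ℕ) + 1 < n) => (((y, v), i) : Bond Y ν n)) v i hv a j =
      (Rtr W hW (y, v) * W ((y, v), i) * (Rtr W hW (y, succOff v i hv))ᵀ) a j := by
  rw [CovariantBoxPoincare.hol, Matrix.mul_apply]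
  simp_rw [Matrix.mul_apply, Matrix.transpose_apply, Finset.sum_mul]
  rw [Finset.sum_comm]
  rfl

/-- **… and minus `1` it is an orthogonal conjugate of the lineage's holonomy defect**:
`Rtr(x)·W_b·Rtr(x⁺)ᵀ − 1 = Rtr(x)·(hol_owner b − 1)·Rtr(x)ᵀ`, `hol_owner b = W_b·Rtr(tgt b)ᵀ·Rtr(src b)`
(`CoarseCoerciveCovariantEnergy.hol` with `Rfam`). [folklore] -/
theorem hol_blocks_sub_one_eq_conj (v : Off ν n) (i : Fin ν) (hv : (v i : ℕ) + 1 < n) :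
    Rtr W hW (y, v) * W ((y, v), i) * (Rtr W hW (y, succOff v i hv))ᵀ - 1 =
      Rtr W hW (y, v) *
        (CoarseCoerciveCovariantEnergy.hol bsrc (btgt σ) W (Rfam W hW) (((y, v), i) : Bond Y ν n) y - 1) *
          (Rtr W hW (y, v))ᵀ := by
  have htgt : btgt σ (((y, v), i) : Bond Y ν n) = (y, succOff v i hv) := btgt_chart σ y v i hv
  rw [CoarseCoerciveCovariantEnergy.hol, htgt]
  simp only [Rfam, bsrc]
  rw [mul_sub, sub_mul, mul_one, Rtr_mul_transpose W hW (y, v)]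
  congr 1
  simp only [Matrix.mul_assoc]
  rw [Rtr_mul_transpose W hW (y, v), Matrix.mul_one]

end Chart

/-! ## §3 The hypothesis `hHol` of `covariant_box_poincare` from `hdef` -/

section Defect

variable {Y : Type} {Cp : Type} [Fintype Cp] [DecidableEq Cp] {ν n : ℕ} [NeZero n]
variable (W : Bond Y ν n → Matrix Cp Cp ℝ) (hW : ∀ b, (W b)ᵀ * W b = 1) (σ : Fin ν → Y → Y) (y : Y)

/-- **`hHol` WITH `h := hdef`, BONDWISE.**  For every in-block bond `((y,v), i)` and every REAL fibre vector `u`: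
`Σ_a (Σ_j (Hol_{aj} − δ_{aj}) u_j)² ≤ hdef(b)²·Σ_j u_j²` — orthogonal conjugation by `Rtr(x)` costs nothing in the
operator norm. [folklore] -/
theorem hHol_of_hdef (v : Off ν n) (i : Fin ν) (hv : (v i : ℕ) + 1 < n) (u : Cp → ℝ) :
    ∑ a, (∑ j, (CovariantBoxPoincare.hol (fun b : Bond Y ν n => (W b : Cp → Cp → ℝ))
        (fun v : Box ν n => (Rtr W hW (y, v) : Cp → Cp → ℝ))
        (fun (v : Box ν n) (i : Fin ν) (_ : (v i : ℕ) + 1 < n) => (((y, v), i) : Bond Y ν n)) v i hv a j -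
          if a = j then 1 else 0) * u j) ^ 2 ≤
      hdef W hW σ (((y, v), i) : Bond Y ν n) y ^ 2 * ∑ j, u j ^ 2 := by
  set H : Matrix Cp Cp ℝ := Rtr W hW (y, v) * W ((y, v), i) * (Rtr W hW (y, succOff v i hv))ᵀ with hH
  set K : Matrix Cp Cp ℝ :=
    CoarseCoerciveCovariantEnergy.hol bsrc (btgt σ) W (Rfam W hW) (((y, v), i) : Bond Y ν n) y with hK
  -- rewrite the quadratic form as that of `H − 1`
  have hq : ∀ a, ∑ j, (CovariantBoxPoincare.hol (fun b : Bond Y ν n => (W b : Cp → Cp → ℝ))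
      (fun v : Box ν n => (Rtr W hW (y, v) : Cp → Cp → ℝ))
      (fun (v : Box ν n) (i : Fin ν) (_ : (v i : ℕ) + 1 < n) => (((y, v), i) : Bond Y ν n)) v i hv a j -
        if a = j then 1 else 0) * u j = ∑ j, (H - 1) a j * u j := by
    intro a
    rw [← sum_sub_delta_mul]
    refine Finset.sum_congr rfl fun j _ => ?_
    rw [hol_blocks_eq W hW y v i hv a j]
  simp_rw [hq]
  refine (sum_sq_mulVec_le (H - 1) u).trans (mul_le_mul_of_nonneg_right ?_ (sum_nonneg fun _ _ => sq_nonneg _))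
  -- ‖cpx(H − 1)‖ ≤ hdef
  have hconj : H - 1 = Rtr W hW (y, v) * (K - 1) * (Rtr W hW (y, v))ᵀ := hol_blocks_sub_one_eq_conj W hW σ y v i hv
  have hnorm : ‖cpxHom (H - 1)‖ ≤ hdef W hW σ (((y, v), i) : Bond Y ν n) y := by
    rw [hconj, map_mul, map_mul, map_sub, map_one]
    have h1 : ‖cpxHom (Rtr W hW (y, v))‖ ≤ 1 := norm_cpxHom_le_one _ (transpose_mul_Rtr W hW (y, v))
    have h2 : ‖cpxHom (Rtr W hW (y, v))ᵀ‖ ≤ 1 :=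
      norm_cpxHom_le_one _ (by rw [Matrix.transpose_transpose]; exact Rtr_mul_transpose W hW (y, v))
    have hd : ‖cpxHom K - 1‖ = hdef W hW σ (((y, v), i) : Bond Y ν n) y := rfl
    calc ‖cpxHom (Rtr W hW (y, v)) * (cpxHom K - 1) * cpxHom (Rtr W hW (y, v))ᵀ‖
        ≤ ‖cpxHom (Rtr W hW (y, v))‖ * ‖cpxHom K - 1‖ * ‖cpxHom (Rtr W hW (y, v))ᵀ‖ :=
          (norm_mul_le _ _).trans (mul_le_mul_of_nonneg_right (norm_mul_le _ _) (norm_nonneg _))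
      _ ≤ 1 * ‖cpxHom K - 1‖ * 1 :=
          mul_le_mul (mul_le_mul_of_nonneg_right h1 (norm_nonneg _)) h2 (norm_nonneg _) (by positivity)
      _ = hdef W hW σ (((y, v), i) : Bond Y ν n) y := by rw [hd]; ring
  exact pow_le_pow_left₀ (norm_nonneg _) hnorm 2

/-- **`hHol` WITH A UNIFORM `h ≥ hdef` ON THE BLOCK'S IN-BOX BONDS** — the shape `covariant_box_poincare` consumes.
[folklore] -/
theorem hHol_of_le {h : ℝ} (hh : ∀ (v : Off ν n) (i : Fin ν), (v i : ℕ) + 1 < n →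
      hdef W hW σ (((y, v), i) : Bond Y ν n) y ≤ h)
    (v : Off ν n) (i : Fin ν) (hv : (v i : ℕ) + 1 < n) (u : Cp → ℝ) :
    ∑ a, (∑ j, (CovariantBoxPoincare.hol (fun b : Bond Y ν n => (W b : Cp → Cp → ℝ))
        (fun v : Box ν n => (Rtr W hW (y, v) : Cp → Cp → ℝ))
        (fun (v : Box ν n) (i : Fin ν) (_ : (v i : ℕ) + 1 < n) => (((y, v), i) : Bond Y ν n)) v i hv a j -
          if a = j then 1 else 0) * u j) ^ 2 ≤
      h ^ 2 * ∑ j, u j ^ 2 := by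
  refine (hHol_of_hdef W hW σ y v i hv u).trans (mul_le_mul_of_nonneg_right ?_ (sum_nonneg fun _ _ => sq_nonneg _))
  exact pow_le_pow_left₀ (hdef_nonneg W hW σ _ y) (hh v i hv) 2

end Defect

/-! ## §4 ENDs: the covariant block Poincaré inequality on the fibred block carrier -/

section End

variable {Y : Type} {Cp : Type} [Fintype Cp] [DecidableEq Cp] {ν n : ℕ} [NeZero n]
variable (W : Bond Y ν n → Matrix Cp Cp ℝ) (hW : ∀ b, (W b)ᵀ * W b = 1) (σ : Fin ν → Y → Y) (y : Y)

/-- **THE COVARIANT BLOCK POINCARÉ INEQUALITY ON BLOCK `y` (defect as data).**  For ANY orthogonal bond transporters `W`,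
any gluing `σ`, bond weights `|c| ≥ c_min > 0` on the block's in-box bonds, and any `h` dominating the lineage's thin-loop
defect `hdef` on those bonds: with `P = νn(n−1)`,
`(1 − 4Pνh²)·Σ_v Σ_k f((y,v),k)² ≤ (4P/c_min²)·Σ_{v,i in-block} Σ_k (∇_W f)(((y,v),i),k)² + (2/n^ν)·Σ_a (Σ_v (Rtr(y,v) f(y,v))_a)²`
— d4-p2's `covariant_box_poincare` BY NAME with `T := Rtr`, `Rm := W`, `hHol` by §3.
[cite: Balaban1985BackgroundPropagators, (3.24) p.394 + (3.35) p.396] -/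
theorem covariant_box_poincare_blocks (c : Bond Y ν n → ℝ) {cmin : ℝ} (hcmin : 0 < cmin)
    (hcb : ∀ (v : Off ν n) (i : Fin ν), (v i : ℕ) + 1 < n → cmin ≤ |c ((y, v), i)|) {h : ℝ}
    (hh : ∀ (v : Off ν n) (i : Fin ν), (v i : ℕ) + 1 < n → hdef W hW σ (((y, v), i) : Bond Y ν n) y ≤ h)
    (f : BSite Y ν n × Cp → ℝ) :
    (1 - 4 * ((ν : ℝ) * n * ((n : ℝ) - 1)) * ν * h ^ 2) * ∑ v : Off ν n, ∑ k, f ((y, v), k) ^ 2 ≤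
      4 * ((ν : ℝ) * n * ((n : ℝ) - 1)) / cmin ^ 2 *
          ∑ v : Off ν n, ∑ i : Fin ν,
            (if (v i : ℕ) + 1 < n then
              ∑ k, covD bsrc (btgt σ) c (fun b : Bond Y ν n => (W b : Cp → Cp → ℝ)) f (((y, v), i), k) ^ 2 else 0) +
        2 / (n : ℝ) ^ ν * ∑ a, (∑ v : Off ν n, ∑ k, Rtr W hW (y, v) a k * f ((y, v), k)) ^ 2 := by
  have hmain := covariant_box_poincare (St := BSite Y ν n) (Bd := Bond Y ν n) (src := bsrc) (tgt := btgt σ)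
    (fun v : Box ν n => ((y, v) : BSite Y ν n))
    (fun (v : Box ν n) (i : Fin ν) (_ : (v i : ℕ) + 1 < n) => (((y, v), i) : Bond Y ν n))
    (fun _ _ _ => rfl) (fun v i hv => btgt_chart σ y v i hv) c hcmin (fun v i hv => hcb v i hv)
    (fun b : Bond Y ν n => (W b : Cp → Cp → ℝ)) (fun v : Box ν n => (Rtr W hW (y, v) : Cp → Cp → ℝ))
    (fun v i i' => Rtr_cols_orthonormal W hW (y, v) i i') (hHol_of_le W hW σ y hh) f
  simpa only [tf, dite_eq_ite] using hmain

/-- **… FROM THE IN-BLOCK PLAQUETTES**: if every plaquette of `W` inside the blocks is within `α` of `1`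
(`ℓ²`-operator norm of the complexification), the defect is `≤ ν(n−1)·α` on every in-block bond
(`CovariantPlateauBlocks.hdef_le_of_plaqW`), so the inequality holds with `h = ν(n−1)·α`: loss
`4Pν·(ν(n−1)α)² ≍ 4ν⁴(n²α)²` — n-uniform exactly in print's regime `n²α = O(Mα₀)`.
[cite: Balaban1985BackgroundPropagators, (3.24) p.394 + (3.35) p.396] -/
theorem covariant_box_poincare_blocks_of_plaqW [Nonempty Cp] (c : Bond Y ν n → ℝ) {cmin : ℝ} (hcmin : 0 < cmin)
    (hcb : ∀ (v : Off ν n) (i : Fin ν), (v i : ℕ) + 1 < n → cmin ≤ |c ((y, v), i)|) {α : ℝ} (hα : 0 ≤ α)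
    (hplaqW : ∀ (y : Y) (v : Off ν n) (κ μ : Fin ν) (hκ : (v κ : ℕ) + 1 < n) (hμ : (v μ : ℕ) + 1 < n), κ ≠ μ →
      ‖cpxHom (plaqW W y v κ μ hκ hμ) - 1‖ ≤ α)
    (f : BSite Y ν n × Cp → ℝ) :
    (1 - 4 * ((ν : ℝ) * n * ((n : ℝ) - 1)) * ν * (ν * ((n : ℝ) - 1) * α) ^ 2) * ∑ v : Off ν n, ∑ k, f ((y, v), k) ^ 2 ≤
      4 * ((ν : ℝ) * n * ((n : ℝ) - 1)) / cmin ^ 2 *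
          ∑ v : Off ν n, ∑ i : Fin ν,
            (if (v i : ℕ) + 1 < n then
              ∑ k, covD bsrc (btgt σ) c (fun b : Bond Y ν n => (W b : Cp → Cp → ℝ)) f (((y, v), i), k) ^ 2 else 0) +
        2 / (n : ℝ) ^ ν * ∑ a, (∑ v : Off ν n, ∑ k, Rtr W hW (y, v) a k * f ((y, v), k)) ^ 2 :=
  covariant_box_poincare_blocks W hW σ y c hcmin hcb
    (fun v i hv => hdef_le_of_plaqW W hW σ hα hplaqW (b := (((y, v), i) : Bond Y ν n)) hv y) f

/-- **… FROM THE (3.35) SHAPE AS DISPLAYED** (both halves: `|A| ≤ a`-type smallness of the gauged bond variables and the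
ORDINARY-gradient bound `f` between parallel neighbouring bonds, for some orthogonal gauge `g`): the in-block plaquettes
are within `α = 2f + 2a²` of `1` (`CovariantPlateauBlocksPairCurl.hplaqW_of_gauge335`, b09-g7's `B9Eq335Plaquette` §1
BY NAME), so the inequality holds with `h = ν(n−1)·(2f + 2a²)`.
[cite: Balaban1985BackgroundPropagators, (3.35) p.396] -/
theorem covariant_box_poincare_blocks_of_gauge335 [Nonempty Cp] (c : Bond Y ν n → ℝ) {cmin : ℝ} (hcmin : 0 < cmin)
    (hcb : ∀ (v : Off ν n) (i : Fin ν), (v i : ℕ) + 1 < n → cmin ≤ |c ((y, v), i)|)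
    (g : Y → Off ν n → Matrix Cp Cp ℝ) (hg : ∀ y v, (g y v)ᵀ * g y v = 1) {a f : ℝ} (hf : 0 ≤ f)
    (h335A : ∀ (y : Y) (v : Off ν n) (κ : Fin ν) (h : (v κ : ℕ) + 1 < n),
      ‖cpxHom (g y v * W ((y, v), κ) * (g y (succOff v κ h))ᵀ) - 1‖ ≤ a)
    (h335F : ∀ (y : Y) (v : Off ν n) (κ μ : Fin ν) (hκ : (v κ : ℕ) + 1 < n) (hμ : (v μ : ℕ) + 1 < n)
      (hκ' : ((succOff v μ hμ) κ : ℕ) + 1 < n),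
      ‖cpxHom (g y (succOff v μ hμ) * W ((y, succOff v μ hμ), κ) * (g y (succOff (succOff v μ hμ) κ hκ'))ᵀ) -
        cpxHom (g y v * W ((y, v), κ) * (g y (succOff v κ hκ))ᵀ)‖ ≤ f)
    (F : BSite Y ν n × Cp → ℝ) :
    (1 - 4 * ((ν : ℝ) * n * ((n : ℝ) - 1)) * ν * (ν * ((n : ℝ) - 1) * (2 * f + 2 * a ^ 2)) ^ 2) *
        ∑ v : Off ν n, ∑ k, F ((y, v), k) ^ 2 ≤
      4 * ((ν : ℝ) * n * ((n : ℝ) - 1)) / cmin ^ 2 *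
          ∑ v : Off ν n, ∑ i : Fin ν,
            (if (v i : ℕ) + 1 < n then
              ∑ k, covD bsrc (btgt σ) c (fun b : Bond Y ν n => (W b : Cp → Cp → ℝ)) F (((y, v), i), k) ^ 2 else 0) +
        2 / (n : ℝ) ^ ν * ∑ a', (∑ v : Off ν n, ∑ k, Rtr W hW (y, v) a' k * F ((y, v), k)) ^ 2 :=
  covariant_box_poincare_blocks_of_plaqW W hW σ y c hcmin hcb (by positivity)
    (fun y v κ μ hκ hμ hκμ => CovariantPlateauBlocksPairCurl.hplaqW_of_gauge335 W hW g hg h335A h335F y v κ μ hκ hμ hκμ) F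

end End

/-! ## §5 Non-vacuity -/

/-- One flat block: `ν = 2`, `n = 2`, one block (`Y = Unit`), fibre `Unit`, `W ≡ 1`, unit bond weights, `α = 0` — every
hypothesis of `covariant_box_poincare_blocks_of_plaqW` is discharged (`hW`, `hcb` by `simp`, the in-block plaquettes of the
flat transporter are `1`), and the END elaborates with loss factor `1 − 4P·ν·0² = 1`. [folklore] -/
example (f : BSite Unit 2 2 × Unit → ℝ) :=
  covariant_box_poincare_blocks_of_plaqW (ν := 2) (n := 2) (fun _ : Bond Unit 2 2 => (1 : Matrix Unit Unit ℝ))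
    (fun _ => by simp) (fun (_ : Fin 2) (_ : Unit) => ()) () (fun _ => (1 : ℝ)) (cmin := 1) one_pos
    (fun _ _ _ => by simp) (α := 0) le_rfl (fun y v κ μ hκ hμ _ => by simp [plaqW]) f

end

end Summit.QuantumFields.BalabanUV.Beta.CovariantBoxPoincareBlocks
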